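import Summits.AtomisticToContinuum.HydrodynamicLimit.Theorems.JParityClosureLocalSecondLawEquilibriumColdBallsDefs
import Summits.AtomisticToContinuum.HydrodynamicLimit.Theorems.JParityClosureLocalSecondLawEquilibriumColdBallsPointwise
import Summits.AtomisticToContinuum.HydrodynamicLimit.Theorems.JParityClosureLocalSecondLawCoarseFieldBounds

/-!
# Cold balls at frozen positions, part 1 (lead c3): tools

Stub `eq_coldBalls` of the equilibrium side-composition of line `exact-entropy-ledger-three-passivities` for the crux
`JParityClosure.LocalSecondLaw` (stmt-AtomisticToContinuum-13081).  For FIXED positions `xs` (weights `bᵢ = b_r(xsᵢ, x₀) ∈ [0, B]`,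
`B = 3/(πr³)`, `W = ∑ bᵢ`) the product-Maxwellian integral of `coldStat = ρ_r (1 + log² θ_r) clamp(2 − 4θ_r/Θ, 0, 1)` is
estimated in three regimes (part 2, `…ColdBallsFrozenCases`; the bound itself in part 3, `…ColdBallsFrozenBound`).  This file:
the deterministic tools (dyadic localisation, the logarithmic bookkeeping
`1 + log²θ ≤ c₀ + 4(log⁺A)² + 16(log⁺d⁻¹)²` of a cold ball with `(Θ/2)/θ ≤ A d⁻²`, the cut, the empty/singleton case
`coldStat ≤ B/(N+1)`, the pair lower bound `bᵢbⱼ‖vᵢ−vⱼ‖² ≤ 3θ_r W²`; the cone bound, `ρ_r` at frozen positions and the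
null set of coincident velocities are the sibling seat's `cone_le_const`, `rhoC_zipConfig`, `coldBalls_velEqNull`), the
Chebyshev constant `coldK` and the Chebyshev bound `Q{θ_r < Θ/2} ≤ (∑pᵢ²)·K` of the cold event (registered sub-goal
`pi_gaussMeasure_cold_le`), and Borel measurability at frozen positions.  Everything sits in the sub-namespace `ColdFrozen`.

References: H. Spohn, *Large Scale Dynamics of Interacting Particles* (1991), Part I §2.3 (homogeneous Gibbs law: configurational
Gibbs measure ⊗ product Maxwellian); S. Goldstein, J. L. Lebowitz, Physica D 193 (2004) 53–66 (typicality of coarse-grained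
observables at equilibrium).
-/

noncomputable section

namespace Summit.AtomisticToContinuum.HydrodynamicLimit.Theorems.LocalSecondLawEquilibrium.ColdFrozen

open scoped BigOperators Topology Classical MeasureTheory ENNReal InnerProductSpace
open Filter Set MeasureTheory ProbabilityTheory
open Literature.MathematicalPhysics.KineticTheory
open Literature.Analysis.FluidPDE
open Summit.AtomisticToContinuum.HydrodynamicLimit.Theorems.LocalSecondLawNegative
open Summit.AtomisticToContinuum.HydrodynamicLimit.Theorems.LocalSecondLawLedger
open Summit.AtomisticToContinuum.HydrodynamicLimit.Theorems.LocalSecondLawLedger.L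

variable {N : ℕ}

/-! ## Small deterministic tools -/

/-- Dyadic localisation of a number in `(0, 1]`. -/
theorem exists_dyadic {t : ℝ} (ht0 : 0 < t) (ht1 : t ≤ 1) :
    ∃ m : ℕ, (2 : ℝ)⁻¹ ^ (m + 1) < t ∧ t ≤ (2 : ℝ)⁻¹ ^ m := by
  have hex : ∃ m : ℕ, (2 : ℝ)⁻¹ ^ (m + 1) < t := by
    obtain ⟨m, hm⟩ := exists_pow_lt_of_lt_one ht0 (by norm_num : (2 : ℝ)⁻¹ < 1)
    exact ⟨m, lt_of_le_of_lt (pow_le_pow_of_le_one (by norm_num) (by norm_num) (Nat.le_succ m)) hm⟩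
  classical
  refine ⟨Nat.find hex, Nat.find_spec hex, ?_⟩
  rcases Nat.eq_zero_or_pos (Nat.find hex) with h0 | hpos
  · rw [h0, pow_zero]; exact ht1
  · have hmin := Nat.find_min hex (Nat.sub_one_lt_of_lt hpos)
    rw [Nat.sub_one_add_one_eq_of_pos hpos] at hmin
    exact not_lt.1 hmin

/-- The logarithmic bookkeeping of a cold ball: if `0 < θ < Θ/2` and `(Θ/2)/θ ≤ A · d⁻²` (`A, d > 0`), then
`1 + log²θ ≤ c₀(Θ) + 4 (log⁺A)² + 16 (log⁺ d⁻¹)²`. -/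
theorem one_add_log_sq_le' {θ Θ A d : ℝ} (hθ : 0 < θ) (hcold : θ < Θ / 2) (hA : 0 < A) (hd : 0 < d)
    (hu : Θ / 2 / θ ≤ A * (d ^ 2)⁻¹) :
    1 + Real.log θ ^ 2 ≤ coldC0 Θ + 4 * (max 0 (Real.log A)) ^ 2 + 16 * (max 0 (Real.log d⁻¹)) ^ 2 := by
  have hΘ2 : 0 < Θ / 2 := hθ.trans hcold
  set u : ℝ := Θ / 2 / θ with hu_def
  have hu1 : 1 < u := by rw [hu_def, one_lt_div hθ]; exact hcold
  have hlogθ : Real.log θ = Real.log (Θ / 2) - Real.log u := by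
    rw [hu_def, Real.log_div hΘ2.ne' hθ.ne']; ring
  have hlogu0 : 0 ≤ Real.log u := Real.log_nonneg hu1.le
  have hlogu : Real.log u ≤ max 0 (Real.log A) + 2 * max 0 (Real.log d⁻¹) := by
    have h1 : Real.log u ≤ Real.log (A * (d ^ 2)⁻¹) := Real.log_le_log (by positivity) hu
    have h2 : Real.log (A * (d ^ 2)⁻¹) = Real.log A + 2 * Real.log d⁻¹ := by
      rw [Real.log_mul hA.ne' (by positivity), Real.log_inv, Real.log_inv, Real.log_pow]; push_cast; ring
    rw [h2] at h1
    nlinarith [le_max_right 0 (Real.log A), le_max_right 0 (Real.log d⁻¹)]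
  have hsq : Real.log u ^ 2 ≤ 2 * (max 0 (Real.log A)) ^ 2 + 8 * (max 0 (Real.log d⁻¹)) ^ 2 := by
    have h0 : 0 ≤ max 0 (Real.log A) := le_max_left _ _
    have h0' : 0 ≤ max 0 (Real.log d⁻¹) := le_max_left _ _
    have := pow_le_pow_left₀ hlogu0 hlogu 2
    nlinarith [sq_nonneg (max 0 (Real.log A) - 2 * max 0 (Real.log d⁻¹))]
  have hθsq : Real.log θ ^ 2 ≤ 2 * Real.log (Θ / 2) ^ 2 + 2 * Real.log u ^ 2 := by
    rw [hlogθ]; nlinarith [sq_nonneg (Real.log (Θ / 2) + Real.log u)]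
  unfold coldC0
  linarith

/-! ## The cold cutoff -/

/-- The cut is in `[0, 1]` and vanishes on `θ ≥ Θ/2`; hence `coldStat ≤ ρ (1 + log²θ) 𝟙[θ < Θ/2]`. -/
theorem coldStat_le_indicator {Θ r : ℝ} (hΘ : 0 < Θ) (hr : 0 < r) (xs : Fin (N + 1) → T3) (x₀ : T3)
    (vs : Fin (N + 1) → V3) :
    coldStat Θ r xs x₀ vs ≤ rhoC r (zipConfig (xs, vs)) x₀ *
      (1 + Real.log (thetaC r (zipConfig (xs, vs)) x₀) ^ 2) *
        (if thetaC r (zipConfig (xs, vs)) x₀ < Θ / 2 then 1 else 0) := by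
  unfold coldStat
  refine mul_le_mul_of_nonneg_left ?_ (mul_nonneg (rhoC_nonneg hr _ _) (by positivity))
  split_ifs with h
  · exact max_le zero_le_one (min_le_left _ _)
  · refine max_le le_rfl (min_le_of_right_le ?_)
    rw [not_lt] at h
    have : 2 ≤ 4 * thetaC r (zipConfig (xs, vs)) x₀ / Θ := by
      rw [le_div_iff₀ hΘ]; linarith
    linarith

/-! ## Cases A/B: empty or singleton support -/

/-- With at most one particle in the ball, `θ_r = 0`, the cut is `1` and `coldStat = ρ_r ≤ B/(N+1)`. -/
theorem coldStat_le_of_subsingleton :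
    ∀ {N : ℕ} {Θ r : ℝ}, 0 < r → ∀ (xs : Fin (N + 1) → T3) (x₀ : T3), (∀ i j, i ≠ j → cone r (xs i) x₀ = 0 ∨ cone r (xs j) x₀ = 0) → ∀ (vs : Fin (N + 1) → V3), coldStat Θ r xs x₀ vs ≤ 3 / (Real.pi * r ^ 3) / ((N + 1 : ℕ) : ℝ) := by
  intro N Θ r hr xs x₀ hsub vs
  have hθ : thetaC r (zipConfig (xs, vs)) x₀ = 0 :=
    thetaC_eq_zero_of_subsingleton_support r _ x₀ (fun i j hij => by simpa using hsub i j hij)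
  have hcut : max 0 (min 1 (2 - 4 * thetaC r (zipConfig (xs, vs)) x₀ / Θ)) = 1 := by
    rw [hθ]; norm_num
  have hW : ∑ i, cone r (xs i) x₀ ≤ 3 / (Real.pi * r ^ 3) := by
    by_cases hex : ∃ i₀, cone r (xs i₀) x₀ ≠ 0
    · obtain ⟨i₀, hi₀⟩ := hex
      rw [Finset.sum_eq_single i₀ (fun j _ hj => ?_) (fun h => absurd (Finset.mem_univ i₀) h)]
      · exact cone_le_const hr _ _
      · rcases hsub j i₀ hj with h | h
        · exact h
        · exact absurd h hi₀
    · push Not at hex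
      rw [Finset.sum_eq_zero fun i _ => hex i]; positivity
  have hmain : ((N + 1 : ℕ) : ℝ)⁻¹ * ∑ i, cone r (xs i) x₀ ≤ 3 / (Real.pi * r ^ 3) / ((N + 1 : ℕ) : ℝ) := by
    rw [div_eq_mul_inv, mul_comm (3 / (Real.pi * r ^ 3))]
    exact mul_le_mul_of_nonneg_left hW (by positivity)
  unfold coldStat
  rw [hcut, hθ, Real.log_zero, rhoC_zipConfig]
  simpa using hmain

/-! ## The pair lower bound of the temperature at frozen positions -/

/-- `bᵢ bⱼ ‖vᵢ − vⱼ‖² ≤ 3 θ_r W²` for every pair `i ≠ j` (`W = ∑ b`, from `coldBalls_pairBound`). -/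
theorem pair_le_theta_W_sq {r : ℝ} (hr : 0 < r) (xs : Fin (N + 1) → T3) (x₀ : T3) (vs : Fin (N + 1) → V3)
    {i j : Fin (N + 1)} (hij : i ≠ j) (hW : 0 < ∑ k, cone r (xs k) x₀) :
    cone r (xs i) x₀ * cone r (xs j) x₀ * ‖vs i - vs j‖ ^ 2 ≤
      3 * thetaC r (zipConfig (xs, vs)) x₀ * (∑ k, cone r (xs k) x₀) ^ 2 := by
  have hn : (0 : ℝ) < ((N + 1 : ℕ) : ℝ) := by positivity
  have hρ : rhoC r (zipConfig (xs, vs)) x₀ = ((N + 1 : ℕ) : ℝ)⁻¹ * ∑ k, cone r (xs k) x₀ := rhoC_zipConfig r xs vs x₀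
  have hρ0 : rhoC r (zipConfig (xs, vs)) x₀ ≠ 0 := by rw [hρ]; positivity
  have h := coldBalls_pairBound hr (zipConfig (xs, vs)) x₀ hρ0 hij
  simp only [zipConfig_apply] at h
  rw [hρ] at h
  have h2 : ((N + 1 : ℕ) : ℝ)⁻¹ ^ 2 * (cone r (xs i) x₀ * cone r (xs j) x₀ * ‖vs i - vs j‖ ^ 2) ≤
      ((N + 1 : ℕ) : ℝ)⁻¹ ^ 2 * (3 * thetaC r (zipConfig (xs, vs)) x₀ * (∑ k, cone r (xs k) x₀) ^ 2) := by
    calc _ ≤ 3 * thetaC r (zipConfig (xs, vs)) x₀ * (((N + 1 : ℕ) : ℝ)⁻¹ * ∑ k, cone r (xs k) x₀) ^ 2 := h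
      _ = _ := by ring
  exact le_of_mul_le_mul_left h2 (by positivity)

/-! ## Measurability at frozen positions -/

/-- The velocity section `vs ↦ zip(xs, vs)` is measurable. -/
theorem measurable_zip_section (xs : Fin (N + 1) → T3) :
    Measurable fun vs : Fin (N + 1) → V3 => zipConfig (xs, vs) :=
  measurable_zipConfig.comp (measurable_const.prodMk measurable_id)

/-- The coarse density, momentum and kinetic energy are Borel in the configuration at a fixed field point. -/
theorem measurable_fields_section (r : ℝ) (x : T3) :
    Measurable (fun w : Phase N => rhoC r w x) ∧ Measurable (fun w : Phase N => momC r w x) ∧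
      Measurable (fun w : Phase N => kinC r w x) := by
  refine ⟨?_, ?_, ?_⟩
  · have h := (continuous_rhoC_uncurry (N := N) r).comp (Continuous.prodMk_left x)
    exact (by simpa only [Function.comp_def] using h : Continuous fun w : Phase N => rhoC r w x).measurable
  · have h := (continuous_momC_uncurry (N := N) r).comp (Continuous.prodMk_left x)
    exact (by simpa only [Function.comp_def] using h : Continuous fun w : Phase N => momC r w x).measurable
  · have h := (continuous_kinC_uncurry (N := N) r).comp (Continuous.prodMk_left x)
    exact (by simpa only [Function.comp_def] using h : Continuous fun w : Phase N => kinC r w x).measurable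

/-- The coarse temperature is Borel in the configuration at a fixed field point. -/
theorem measurable_thetaC_section (r : ℝ) (x : T3) : Measurable fun w : Phase N => thetaC r w x := by
  obtain ⟨hρ, hm, hk⟩ := measurable_fields_section (N := N) r x
  unfold thetaC
  exact ((hk.div hρ).sub ((hm.norm.pow_const 2).div ((hρ.pow_const 2).const_mul 2))).const_mul _

/-- The `log⁺(1/‖vᵢ − vⱼ‖)` statistic is Borel. -/
theorem measurable_posLogInv (i j : Fin (N + 1)) :
    Measurable fun vs : Fin (N + 1) → V3 => max 0 (Real.log ‖vs i - vs j‖⁻¹) :=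
  measurable_const.max (Real.measurable_log.comp ((measurable_pi_apply i).sub (measurable_pi_apply j)).norm.inv)


end Summit.AtomisticToContinuum.HydrodynamicLimit.Theorems.LocalSecondLawEquilibrium.ColdFrozen

end
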